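import Mathlib
import Summits.Ventures.PercRepro2.EightTypedAbstract
import Summits.Ventures.PercRepro2.EightTypedDomLeaf

/-!
# Eight typed edges, IX.D: kernel group `EightTypedDomShards152` of the domain-restricted rung (blind cell PercRepro2, night-3 g10/g11, 2026-08-26)

The `decide +kernel` units of plan8d.json (night-3 g11: the plan re-costed at the measured ≈ 8.5 s per tested leaf on the three served
guards of `okQ8Dom`, 7,199 tested leaves) packed into this file (leaf units ≤ 8 tested / ≤ 20 full leaves, joins over the candidate
lists of their split prefixes), for the leaf test `okQ8Dom`; elaborated sequentially (`Elab.async false`: the parallel elaboration of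
the real tests exhausts the farm node's thread/memory budget).
-/

set_option Elab.async false
set_option maxHeartbeats 0
set_option maxRecDepth 100000

namespace Summit.Ventures.PercRepro2

open UnionCluster

namespace CovForm

namespace TwoTyped

open OneTyped

section EightTypedDomShards152

/-- the prefix `1 2 3 4 0 3 0 8 1 10 2 3 2 8 2 10 3` (depth 17) as a kernel fact. -/
theorem sh8D_1_2_3_4_0_3_0_8_1_10_2_3_2_8_2_10_3 : csh8_17 okQ8Dom 1 2 3 4 0 3 0 8 1 10 2 3 2 8 2 10 3 = true := by decide +kernel
/-- the prefix `1 2 3 4 0 3 0 8 1 8 1 12 2 3 2 12 3` (depth 17) as a kernel fact. -/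
theorem sh8D_1_2_3_4_0_3_0_8_1_8_1_12_2_3_2_12_3 : csh8_17 okQ8Dom 1 2 3 4 0 3 0 8 1 8 1 12 2 3 2 12 3 = true := by decide +kernel
/-- the prefix `1 2 3 4 0 3 0 8 1 3 1 12 2 8 2 12 3` (depth 17) as a kernel fact. -/
theorem sh8D_1_2_3_4_0_3_0_8_1_3_1_12_2_8_2_12_3 : csh8_17 okQ8Dom 1 2 3 4 0 3 0 8 1 3 1 12 2 8 2 12 3 = true := by decide +kernel
/-- the prefix `1 2 3 4 0 3 0 8 0 10 1 10 2 3 2 8 3` (depth 17) as a kernel fact. -/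
theorem sh8D_1_2_3_4_0_3_0_8_0_10_1_10_2_3_2_8_3 : csh8_17 okQ8Dom 1 2 3 4 0 3 0 8 0 10 1 10 2 3 2 8 3 = true := by decide +kernel

end EightTypedDomShards152

end TwoTyped

end CovForm

end Summit.Ventures.PercRepro2
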